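import Summits.NavierStokesRegularity.NavierStokesRegularity.Theorems.OddMorawetzLocal.Negative.OddMorawetzLocalRefutationDefs

/-!
# Crux `OddMorawetzLocal` (stmt-NavierStokesRegularity-1376) — refutation vocabulary III: merge-sort normal form

Definitions only. The insertion-sort normal form `JPoly.norm` of `OddMorawetzLocalJetAlgebra` is quadratic in the
number of terms; the kernel checks of the refutation that meet polynomials with thousands of terms (the derivation of
an isotropic null density, the divergence-free normal form of a contraction density) use the merge-sort normal form
`JPoly.normF` defined here (same value: sort the variables of each monomial, sort the monomials, add up equal ones,
drop zeros), and the corresponding fast pipelines `derKillsF`, `nfKillsF`, `orbitReconF`, `isoPolyF`.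
-/

set_option linter.dupNamespace false
set_option autoImplicit false

namespace Summit.NavierStokesRegularity.NavierStokesRegularity.Theorems.OddMorawetz

namespace JPoly

variable {R : Type}

/-- Merge two monomial-sorted term lists (by `monoCmp`), keeping all terms (stable: ties from the left first);
`fuel` bounds the recursion (use `fuel ≥` total length). -/
def mergeTerms : ℕ → List (R × List JVar) → List (R × List JVar) → List (R × List JVar)
  | 0, p, q => p ++ q
  | _ + 1, [], q => q
  | _ + 1, p, [] => p
  | fuel + 1, s :: ps, t :: qs => match monoCmp s.2 t.2 with
    | .gt => t :: mergeTerms fuel (s :: ps) qs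
    | _ => s :: mergeTerms fuel ps (t :: qs)

/-- Split a list into the elements at even and at odd positions. -/
def splitAlt : List (R × List JVar) → List (R × List JVar) × List (R × List JVar)
  | [] => ([], [])
  | [a] => ([a], [])
  | a :: b :: rest => let pr := splitAlt rest; (a :: pr.1, b :: pr.2)

/-- Merge sort of a term list by `monoCmp` on monomials; `fuel` bounds the recursion depth (use `fuel ≥ length`). -/
def msort : ℕ → List (R × List JVar) → List (R × List JVar)
  | 0, p => p
  | _ + 1, [] => []
  | _ + 1, [a] => [a]
  | fuel + 1, a :: b :: rest =>
    let pr := splitAlt (a :: b :: rest)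
    mergeTerms (rest.length + 2) (msort fuel pr.1) (msort fuel pr.2)

/-- Collect with an accumulator: add up the coefficients of equal ADJACENT monomials of a monomial-sorted list. -/
def collectAcc [Add R] (cur : R × List JVar) : List (R × List JVar) → List (R × List JVar)
  | [] => [cur]
  | t :: rest => if cur.2 = t.2 then collectAcc (cur.1 + t.1, cur.2) rest else cur :: collectAcc t rest

/-- One pass over a monomial-sorted term list adding up the coefficients of equal adjacent monomials. -/
def mergeCollect [Add R] : List (R × List JVar) → List (R × List JVar)
  | [] => []
  | t :: rest => collectAcc t rest

/-- Fast normal form: sort the variables of every monomial, merge-sort the monomials, collect, drop zeros. -/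
def normF [Add R] [Zero R] [DecidableEq R] (p : JPoly R) : JPoly R :=
  (mergeCollect (msort p.length (p.map fun t => (t.1, sortVars t.2)))).filter fun t => t.1 ≠ 0

/-- Is the polynomial zero (fast normal form empty)? -/
def isZeroF [Add R] [Zero R] [DecidableEq R] (p : JPoly R) : Bool := (normF p).isEmpty

/-- Fast divergence-free normal form. -/
def nfF [Mul R] [One R] [Neg R] [Add R] [Zero R] [DecidableEq R] (p : JPoly R) : JPoly R := normF (subst nfVar p)

end JPoly

/-! ### Fast pipelines -/

/-- Does the derivation of `L` kill the polynomial? (fast normal form) -/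
def derKillsF (L : Matrix (Fin 3) (Fin 3) ℤ) (q : JPoly ℤ) : Bool := JPoly.isZeroF (JPoly.derP L q)

/-- Is the polynomial in the divergence-free ideal? (fast normal form) -/
def nfKillsF (q : JPoly ℤ) : Bool := JPoly.isZeroF (JPoly.subst JPoly.nfVar q)

/-- Reconstruction of a polynomial from its orbit coordinates (fast normal forms on both sides). -/
def orbitReconF (reps : List (List JVar)) (q : JPoly ℤ) : Bool :=
  decide (JPoly.normF q = JPoly.normF (reps.flatMap fun m =>
    let c := JPoly.coeffOf q m
    if c = 0 then [] else JPoly.smul c (orbitSumN m)))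

/-- The divergence of the isotropic flux of a descriptor, fast normal form. -/
def isoFluxDivF (shape : List ℕ) (m : List ((ℕ × ℕ) × (ℕ × ℕ))) : JPoly ℤ :=
  JPoly.normF (JPoly.divergence (isoFlux shape m 0, isoFlux shape m 1, isoFlux shape m 2))

/-- The integer jet polynomial of a descriptor, fast normal form (same value as `isoPoly`). -/
def isoPolyF : IsoDesc → JPoly ℤ
  | .dens sh m => JPoly.normF (contractionZ sh m)
  | .null sh m => isoFluxDivF sh m
  | .ideal sh m => JPoly.normF (contractionZ sh m)
  | .poly p => JPoly.normF p

end Summit.NavierStokesRegularity.NavierStokesRegularity.Theorems.OddMorawetz
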